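import Mathlib
import HarnessLib
import Summits.RiemannHypothesis.RiemannHypothesis.Theses.SuzukiWindowsDoor

/-!
# RiemannHypothesis / SuzukiWindowsDoor — `Assembly` (stmt-RiemannHypothesis-19737) PROVED

The assembly step of route `route-RiemannHypothesis-SuzukiWindowsDoor`:
`KernelContinuous → WindowsImplyContraction → ContractionGivesWitness → WitnessDetectsRH → AllWindowsWitness → RH`
— pick the witness's `θ` and chain the four implications; pure logic (no analysis), exactly the route's `closes`.
`AllWindowsWitness` is the route's DECLARED RESIDUAL (RH-EQUIVALENT·DERIVED, never a proving target);
`WindowsImplyContraction` is the open crux A1. RH-FREE; nothing here bears on the truth of RH.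
-/

-- D-0017: `Summit.<S>.<S>.…` is the designed namespace of a single-problem summit.
set_option linter.dupNamespace false

namespace Summit.RiemannHypothesis.RiemannHypothesis.Theorems

/-- **Route `SuzukiWindowsDoor`, `Assembly` (stmt-RiemannHypothesis-19737) — PROVED (pure logic).**
`KernelContinuous → WindowsImplyContraction → ContractionGivesWitness → WitnessDetectsRH → AllWindowsWitness → RH`. -/
theorem suzukiWindowsDoor_assembly_proof :
    Summit.RiemannHypothesis.RiemannHypothesis.Theses.SuzukiWindowsDoor.Assembly := by
  intro hK hA hC hT hR
  obtain ⟨θ, hθ, hWin⟩ := hR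
  exact hT θ hθ (hC _ (hA _ (hK θ hθ) hWin))

end Summit.RiemannHypothesis.RiemannHypothesis.Theorems
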